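import Literature.AlgebraicGeometry.Motives.MixedHodgeStructureCatDualDeligneSplitting
import HarnessLib

/-!
# Complexification commutes with duality: `(X^∨)_ℂ ≅ (X_ℂ)^∨` as a natural isomorphism `MixedHodgeStructureCat → ModuleCat ℂ`

Layer `Literature/AlgebraicGeometry/Motives` (lane `lit-hodgefound`), the categorical dictionary of mixed Hodge structures.  The comparison map
`ℂ ⊗_ℚ V^∨ → (ℂ ⊗_ℚ V)^∨`, `c ⊗ φ ↦ (d ⊗ v ↦ c d φ(v))` (the tree's `HodgeStructure.dualBaseChange`, `Motives/HodgeTensor`; injective always,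
bijective for `V` finite-dimensional, `dualBaseChange_bijective`; natural in `V`, `MixedHodgeStructure.dualBaseChange_dualMap_baseChange`) is the
device through which the dual mixed Hodge structure `X^∨` is defined (`F^p(X^∨) = (F^{1-p} X_ℂ)^⊥` pulled back along it; Cattani–El Zein–Griffiths–Lê
§3.2.2.7, Deligne 1.1.6).  Here it is recorded in the categorical vocabulary (`complexification : MixedHodgeStructureCat ⥤ ModuleCat ℂ`, `X ↦ X_ℂ`,
`Motives/MixedHodgeStructureCatDeligneSplittingFunctor`; `transposeHom`, `dualFunctor`, `FinSubcategory`, `Motives/MixedHodgeStructureCatDualFunctor`):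

* §1 **`complexificationDualIso X : complexification.obj (X^∨) ≅ (complexification.obj X)^∨`** in `ModuleCat ℂ` and its NATURALITY
  `(f^∨)_ℂ ≫ (≅)_X = (≅)_Y ≫ (f_ℂ)^∨`;
* §2 on the finite-dimensional full subcategory: `complexificationDualFunctor : X ↦ (X_ℂ)^∨` and the natural isomorphism
  **`complexificationDualNatIso : dualFunctor ⋙ ι ⋙ complexification ≅ complexificationDualFunctor`** («`(−)_ℂ ∘ (−)^∨ = ((−)^∨) ∘ (−)_ℂ`»);
* §3 compatibility with Deligne's splitting (`Motives/MixedHodgeStructureCatDualDeligneSplitting`, `deligneIDualIso p q X : I^{p,q}(X^∨) ≅ (I^{-p,-q} X)^∨`):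
  the identity `(I^{p,q}(X^∨) ↪ (X^∨)_ℂ) ≫ (≅) ≫ (I^{-p,-q} X ↪ X_ℂ)^∨ = (I^{p,q}(X^∨) ≅ (I^{-p,-q} X)^∨)` — the duality of Deligne pieces is the
  RESTRICTION of the duality of the complexifications.

Everything is PROVED; no named fact, no instance, no notation.

Sources, verbatim.  E. Cattani, F. El Zein, P. A. Griffiths, Lê D. T. (eds.), *Hodge Theory* (Princeton Math. Notes 49, 2014) [CattaniElZeinGriffithsLe2014],
§3.2.2.7 p. 163 («(2) The MHS `Hom(H, H')` … (iii) `F^r Hom(H,H')_ℂ := {f : Hom_ℂ(H_ℂ, H'_ℂ) : …}` … In particular, the dual `H^*` of a mixed Hodge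
structure `H` is an MHS» — the complexification of `Hom(H, ℚ(0))` is `Hom_ℂ(H_ℂ, ℂ)`), Prop. 3.2.19 and Remark (ii).  P. Deligne, *Théorie de Hodge II*
(1971) [DeligneHodgeII1971], 1.1.6 (dual filtration), 2.3.1.  N. Bourbaki, *Algebra I* [BourbakiAlgebraI1989], Ch. II §5 no. 4 (transpose commutes with
extension of scalars) — through the tree's `dualBaseChange_dualMap_baseChange`.  Category theory is Mathlib's [folklore].

## Main results

* §1 **`complexificationDualIso`** (`_hom_hom`, `_hom_hom_apply`, `_inv_hom_dualBaseChange`), **`complexification_map_transposeHom_comp_complexificationDualIso_hom`**,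
  `finrank_complexification_obj_dual`.
* §2 `complexificationDualFunctor` (`_obj`, `_map_hom`), **`complexificationDualNatIso`** (`_hom_app`).
* §3 **`deligneIι_app_comp_complexificationDualIso_hom`**.

## References

* [CattaniElZeinGriffithsLe2014] E. Cattani et al. (eds.), Hodge Theory, Princeton Math. Notes 49 (2014), §3.2.2.7, Prop. 3.2.19.
* [DeligneHodgeII1971] P. Deligne, Théorie de Hodge II, Publ. Math. IHÉS 40 (1971), 1.1.6, 2.3.1.
* [BourbakiAlgebraI1989] N. Bourbaki, Algebra I, Ch. II §5 no. 4.
* [GreenGriffithsKerr2012] M. Green, P. Griffiths, M. Kerr, Mumford–Tate Groups and Domains, Ann. of Math. Studies 183 (2012), Prop. (I.C.2) (ii).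

## Provenance

Lane `lit-hodgefound` (summit `HodgeConjecture`), seat `lit-hodgefound-p36` (literature-prover, generation 47, row g47-#11).
-/

noncomputable section

open CategoryTheory Opposite
open scoped TensorProduct

namespace Literature.AlgebraicGeometry.Motives

open HodgeStructure (dualBaseChange dualBaseChange_injective dualBaseChange_bijective)

universe u

namespace MixedHodgeStructureCat

/-! ## §1 `(X^∨)_ℂ ≅ (X_ℂ)^∨` in `ModuleCat ℂ`, naturally -/

section Ambient

variable {X Y : MixedHodgeStructureCat.{u}} [Module.Finite ℚ X] [Module.Finite ℚ Y]

variable (X) in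
/-- **`complexification.obj (X^∨) ≅ (complexification.obj X)^∨`**: the comparison `ℂ ⊗ X^∨ → (X_ℂ)^∨`, `c ⊗ φ ↦ (d ⊗ v ↦ c d φ(v))`, is an
isomorphism for `X` finite-dimensional. [cite: CattaniElZeinGriffithsLe2014, §3.2.2.7] [cite: DeligneHodgeII1971, 1.1.6] -/
def complexificationDualIso : complexification.obj (of X.str.dual) ≅ ModuleCat.of ℂ (Module.Dual ℂ (complexification.obj X)) :=
  (LinearEquiv.ofBijective (dualBaseChange (X : Type u))
    (dualBaseChange_bijective : Function.Bijective (dualBaseChange (X : Type u)))).toModuleIso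

/-- Unfolding `complexificationDualIso` (hom): it is `dualBaseChange`. [cite: DeligneHodgeII1971, 1.1.6] -/
theorem complexificationDualIso_hom_hom : (complexificationDualIso X).hom.hom = dualBaseChange (X : Type u) := rfl

/-- `(≅) (c ⊗ φ) (d ⊗ v) = c · (φ(v) · d)`. [cite: DeligneHodgeII1971, 1.1.6] -/
theorem complexificationDualIso_hom_hom_tmul_tmul (c d : ℂ) (φ : Module.Dual ℚ X) (v : X) :
    (complexificationDualIso X).hom.hom (c ⊗ₜ[ℚ] φ) (d ⊗ₜ[ℚ] v) = c * (φ v • d) :=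
  HodgeStructure.dualBaseChange_tmul_tmul c d φ v

/-- `dualBaseChange ∘ (≅)⁻¹ = id`. [cite: DeligneHodgeII1971, 1.1.6] -/
@[simp]
theorem dualBaseChange_complexificationDualIso_inv_hom (ψ : Module.Dual ℂ (complexification.obj X)) :
    dualBaseChange (X : Type u) ((complexificationDualIso X).inv.hom ψ) = ψ :=
  (LinearEquiv.ofBijective (dualBaseChange (X : Type u))
    (dualBaseChange_bijective : Function.Bijective (dualBaseChange (X : Type u)))).apply_symm_apply ψ

/-- **Naturality**: for `f : X ⟶ Y`, `(f^∨)_ℂ ≫ (≅)_X = (≅)_Y ≫ (f_ℂ)^∨` — transposition commutes with extension of scalars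
(`dualBaseChange ((f^∨)_ℂ ξ) = (dualBaseChange ξ) ∘ f_ℂ`). [cite: CattaniElZeinGriffithsLe2014, §3.2.2.7] [cite: DeligneHodgeII1971, 1.1.6 and 2.3.1] -/
theorem complexification_map_transposeHom_comp_complexificationDualIso_hom (f : X ⟶ Y) :
    complexification.map (transposeHom f) ≫ (complexificationDualIso X).hom =
      (complexificationDualIso Y).hom ≫ ModuleCat.ofHom (complexification.map f).hom.dualMap :=
  ModuleCat.hom_ext (LinearMap.ext fun ξ => LinearMap.ext fun x =>
    MixedHodgeStructure.dualBaseChange_dualMap_baseChange f.toLinearMap ξ x)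

variable (X) in
/-- `dim_ℂ (X^∨)_ℂ = dim_ℂ X_ℂ` (`= dim_ℚ X`). [cite: CattaniElZeinGriffithsLe2014, §3.2.2.7] -/
theorem finrank_complexification_obj_dual :
    Module.finrank ℂ (complexification.obj (of X.str.dual)) = Module.finrank ℂ (complexification.obj X) :=
  (LinearEquiv.ofBijective (dualBaseChange (X : Type u))
    (dualBaseChange_bijective : Function.Bijective (dualBaseChange (X : Type u)))).finrank_eq.trans Subspace.dual_finrank_eq

/-! ## §3 Compatibility with the duality of Deligne pieces -/

/-- **The duality of Deligne pieces is the restriction of `(X^∨)_ℂ ≅ (X_ℂ)^∨`**: `(I^{p,q}(X^∨) ↪ (X^∨)_ℂ) ≫ (≅) ≫ (I^{-p,-q} X ↪ X_ℂ)^∨ =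
(I^{p,q}(X^∨) ≅ (I^{-p,-q} X)^∨)`. [cite: GreenGriffithsKerr2012, Prop. (I.C.2) (ii)] [cite: CattaniElZeinGriffithsLe2014, Prop. 3.2.19 and §3.2.2.7] -/
theorem deligneIι_app_comp_complexificationDualIso_hom (p q : ℤ) :
    (deligneIι p q).app (of X.str.dual) ≫ (complexificationDualIso X).hom ≫ ModuleCat.ofHom ((deligneIι (-p) (-q)).app X).hom.dualMap =
      (deligneIDualIso p q X).hom :=
  ModuleCat.hom_ext (LinearMap.ext fun _ => LinearMap.ext fun _ => rfl)

end Ambient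

/-! ## §2 On `FinSubcategoryᵒᵖ`: `(−)_ℂ ∘ (−)^∨ ≅ ((−)^∨) ∘ (−)_ℂ` -/

section NatIso

/-- The functor **`X ↦ (X_ℂ)^∨`, `f ↦ (f_ℂ)^∨`** on finite-dimensional mixed Hodge structures (contravariant). [cite: DeligneHodgeII1971, 2.3.1] -/
def complexificationDualFunctor : FinSubcategory.{u}ᵒᵖ ⥤ ModuleCat.{u} ℂ where
  obj X := ModuleCat.of ℂ (Module.Dual ℂ (complexification.obj X.unop.obj))
  map f := ModuleCat.ofHom (complexification.map f.unop.hom).hom.dualMap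
  map_id X := ModuleCat.hom_ext (by
    rw [ModuleCat.hom_ofHom, ModuleCat.hom_id]
    exact (congrArg (fun g => (ModuleCat.Hom.hom g).dualMap) (complexification.map_id X.unop.obj)).trans LinearMap.dualMap_id)
  map_comp f g := ModuleCat.hom_ext (by
    rw [ModuleCat.hom_ofHom, ModuleCat.hom_comp, ModuleCat.hom_ofHom, ModuleCat.hom_ofHom]
    exact (congrArg (fun g => (ModuleCat.Hom.hom g).dualMap) (complexification.map_comp g.unop.hom f.unop.hom)).trans
      (LinearMap.dualMap_comp_dualMap _ _).symm)

/-- Unfolding `complexificationDualFunctor` on objects. [cite: DeligneHodgeII1971, 2.3.1] -/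
theorem complexificationDualFunctor_obj (X : FinSubcategory.{u}ᵒᵖ) :
    complexificationDualFunctor.obj X = ModuleCat.of ℂ (Module.Dual ℂ (complexification.obj X.unop.obj)) := rfl

/-- Unfolding `complexificationDualFunctor` on morphisms. [cite: DeligneHodgeII1971, 2.3.1] -/
theorem complexificationDualFunctor_map_hom {X Y : FinSubcategory.{u}ᵒᵖ} (f : X ⟶ Y) :
    (complexificationDualFunctor.map f).hom = (complexification.map f.unop.hom).hom.dualMap := rfl

/-- **`(−)_ℂ ∘ (−)^∨ ≅ ((−)^∨) ∘ (−)_ℂ`**: complexification commutes with the duality functor of finite-dimensional mixed Hodge structures,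
as a natural isomorphism of functors `FinSubcategoryᵒᵖ ⥤ ModuleCat ℂ` (components `complexificationDualIso`).
[cite: CattaniElZeinGriffithsLe2014, §3.2.2.7] [cite: DeligneHodgeII1971, 1.1.6 and 2.3.1] -/
def complexificationDualNatIso : dualFunctor.{u} ⋙ isFinite.ι ⋙ complexification ≅ complexificationDualFunctor :=
  NatIso.ofComponents
    (fun X => haveI : Module.Finite ℚ X.unop.obj := X.unop.property; complexificationDualIso X.unop.obj)
    (fun {X Y} f => by
      haveI : Module.Finite ℚ X.unop.obj := X.unop.property
      haveI : Module.Finite ℚ Y.unop.obj := Y.unop.property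
      exact complexification_map_transposeHom_comp_complexificationDualIso_hom f.unop.hom)

/-- Components of `complexificationDualNatIso`. [cite: DeligneHodgeII1971, 1.1.6] -/
theorem complexificationDualNatIso_hom_app (X : FinSubcategory.{u}ᵒᵖ) :
    complexificationDualNatIso.hom.app X = (haveI : Module.Finite ℚ X.unop.obj := X.unop.property; (complexificationDualIso X.unop.obj).hom) :=
  rfl

end NatIso

end MixedHodgeStructureCat

end Literature.AlgebraicGeometry.Motives
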